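import Mathlib
import Literature.NumberTheory.LFunctions.Zhang2022.KnifeEdgeInvisibleTailFamily

/-!
# Zhang (2022), rung F-S3 (Landau–Siegel programme), sub-cell E: the invisible tail AT THE BAND SCALE —
# smooth `χψ`-coefficients beyond `n ≥ D·P·𝓛^{1056+2A}` (= `z ≥ 1 + α̃ + O(log𝓛/𝓛⁹)`) are pointwise `≤ C·𝓛^{−A}`

Y. Zhang, *Discrete mean estimates and the Landau–Siegel zero*, arXiv:2211.02515v1 [Zhang2022LandauSiegel] —
an unrefereed manuscript under adjudication. **WHAT THIS IS NOT: not a claim about Theorems 1–2 of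
arXiv:2211.02515, about Landau–Siegel zeros, or about Parity. The programme SEARCHES and TYPES.** Nothing of the
manuscript is used: the only input is Pólya–Vinogradov + Abel summation in the tree
(`KnifeEdgeInvisibleTail.norm_sum_Ioc_char_profile_cpow_le`, p445477) and the primitivity of `χψ (mod Dp)`
(`Skeleton.psiChiPrimitive_holds`).

**Why (the E-004 seam, ls-barrier-p2 slice).** The tree's invisible-tail theorems (`tailInvisible`, p446031;
`KnifeEdgeSmoothClass.*`, p456650/p456962) start at `X ≥ P^{1+ε}` for a FIXED `ε > 0` and save `P^{−ε/4}`; the barrier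
families built on them (`familyFarPiece`, `familySmoothLengths`, `familyWallZero(Main)`) therefore leave the whole
fixed-width band `z ∈ (1, 1+ε]` to a displayed slot (registry E-004). But the engine bound is explicit —
`√q(1+log q)·X^{−Re s}·(1 + (log Y − log X)/log P + ‖s‖(1 + 1/Re s))` with `q = Dp ≤ 3DP`, `‖s‖ ≤ 2 + 8t₀ = 2 + 8𝓛⁵¹⁹` —
so the tail is already invisible from the TRUE band edge: for every `A`, once `X ≥ D·P·𝓛^{1056+2A}`
(`log X/log P ≥ 1 + α̃ + (537+2A)·log𝓛/𝓛⁹`, `α̃ = log(Dt₀)/log P = (𝓛 + 519 log𝓛)/𝓛⁹`, (2.30)), every block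
`X < n ≤ Y ≤ P^{1+δ}` of a 1-Lipschitz profile polynomial is `≤ 4(52+δ)e^{2+δ}·𝓛^{−A}` at every point of the critical
range (`tailInvisible_bandScale`). The polylog saving `𝓛^{−A}` (any `A`) replaces `P^{−ε/4}`; against the trivial scale
`discWeight ≍ 𝓛⁹𝔓` (`Skeleton.discWeight_trivialScale`, p467613) a saving `𝓛^{−2A}` with `A ≥ 5` on the squared tail is
already `o(𝔞𝔓)` — so the E-004 seam of the disc-mean families shrinks from a fixed-width band to the
`(1 + o(1))·α̃`-band. The discrete-mean corollaries (sampled zeros, flatness from the band edge) follow in a sequel.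

References: Montgomery–Vaughan, *Multiplicative Number Theory I*, Thm 9.18 (Pólya–Vinogradov)
[cite: MontgomeryVaughan2007, Thm 9.18]; Zhang, arXiv:2211.02515v1, §2 (2.6), (2.14), (2.30), §4 p. 8, §7 (7.2)
[cite: Zhang2022LandauSiegel, §2 (2.30), §7 (7.2)].
-/

noncomputable section

open Complex Real Finset

namespace Literature.NumberTheory.LFunctions.Zhang2022.KnifeEdgeInvisibleTail

open Skeleton

/-! ### Bookkeeping (private; the √q and bracket budgets are those of `tailInvisible`, restated) -/

/-- `p ≤ 3P` for a member of the family. [cite: Zhang2022LandauSiegel, §2 p. 4] -/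
private theorem chr_p_le_three_mul_bigP'' {D : ℕ} (x : Chr D) (hL : 1 ≤ ell D) : (x.p : ℝ) ≤ 3 * bigP D := by
  have hm := x.mem
  rw [primeWindow, Finset.mem_filter, Finset.mem_Ioo] at hm
  have hP : 0 < bigP D := Real.exp_pos _
  have hP1 : 1 ≤ bigP D := by rw [bigP]; exact Real.one_le_exp (by positivity)
  have hℓ : (ell D ^ 68)⁻¹ ≤ 1 := inv_le_one_of_one_le₀ (one_le_pow₀ hL)
  have h1 : (x.p : ℝ) < ⌈bigP D * (1 + (ell D ^ 68)⁻¹)⌉₊ := by exact_mod_cast hm.1.2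
  have h2 : (⌈bigP D * (1 + (ell D ^ 68)⁻¹)⌉₊ : ℝ) < bigP D * (1 + (ell D ^ 68)⁻¹) + 1 :=
    Nat.ceil_lt_add_one (by positivity)
  nlinarith

/-- `L ≤ log D` once `⌈e^L⌉ ≤ D`. [folklore] -/
private theorem le_ell_of_ceil_exp_le'' {L₀ : ℝ} {D : ℕ} (hD : ⌈Real.exp L₀⌉₊ ≤ D) : L₀ ≤ ell D := by
  have h : Real.exp L₀ ≤ (D : ℝ) := (Nat.le_ceil _).trans (by exact_mod_cast hD)
  exact (Real.le_log_iff_exp_le (lt_of_lt_of_le (Real.exp_pos _) h)).mpr h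

/-- (i) `√q (1 + log q) ≤ e · e^{𝓛/2} e^{𝓛⁹/2} · 4𝓛⁹` for `1 ≤ q ≤ 3 D P`, `D = e^𝓛`, `P = e^{𝓛⁹}`, `𝓛 ≥ 4`.
[folklore] -/
private theorem budget_sqrt_log' {ℓ Dr q : ℝ} (hℓ4 : 4 ≤ ℓ) (hDr : Real.exp ℓ = Dr) (hq1 : 1 ≤ q)
    (hq : q ≤ 3 * (Dr * Real.exp (ℓ ^ 9))) :
    Real.sqrt q * (1 + Real.log q) ≤
      (Real.exp 1 * (Real.exp (ℓ / 2) * Real.exp (ℓ ^ 9 / 2))) * (4 * ℓ ^ 9) := by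
  have hℓ1 : 1 ≤ ℓ := by linarith
  have hℓ9 : ℓ ≤ ℓ ^ 9 := by
    calc ℓ = ℓ ^ 1 := (pow_one ℓ).symm
      _ ≤ ℓ ^ 9 := pow_le_pow_right₀ hℓ1 (by norm_num)
  have hDr0 : 0 < Dr := by rw [← hDr]; exact Real.exp_pos _
  have h3e : (3 : ℝ) ≤ Real.exp 2 := by have := Real.add_one_le_exp (2:ℝ); linarith
  have hsqrt : Real.sqrt q ≤ Real.exp 1 * (Real.exp (ℓ / 2) * Real.exp (ℓ ^ 9 / 2)) := by
    have h1 : q ≤ Real.exp (ℓ + 2) * Real.exp (ℓ ^ 9) := by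
      calc q ≤ 3 * (Dr * Real.exp (ℓ ^ 9)) := hq
        _ = 3 * Real.exp ℓ * Real.exp (ℓ ^ 9) := by rw [hDr]; ring
        _ ≤ Real.exp 2 * Real.exp ℓ * Real.exp (ℓ ^ 9) := by gcongr
        _ = Real.exp (ℓ + 2) * Real.exp (ℓ ^ 9) := by rw [Real.exp_add]; ring
    calc Real.sqrt q ≤ Real.sqrt (Real.exp (ℓ + 2) * Real.exp (ℓ ^ 9)) := Real.sqrt_le_sqrt h1
      _ = Real.sqrt (Real.exp (ℓ + 2)) * Real.sqrt (Real.exp (ℓ ^ 9)) :=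
          Real.sqrt_mul (Real.exp_pos _).le _
      _ = Real.exp ((ℓ + 2) / 2) * Real.exp (ℓ ^ 9 / 2) := by rw [← Real.exp_half, ← Real.exp_half]
      _ = Real.exp 1 * (Real.exp (ℓ / 2) * Real.exp (ℓ ^ 9 / 2)) := by
          rw [show (ℓ + 2) / 2 = 1 + ℓ / 2 by ring, Real.exp_add]; ring
  have hlog3 : Real.log 3 ≤ 2 := by
    have := Real.log_le_sub_one_of_pos (by norm_num : (0:ℝ) < 3); linarith
  have hlogq : 1 + Real.log q ≤ 4 * ℓ ^ 9 := by
    have h1 : Real.log q ≤ Real.log (3 * (Dr * Real.exp (ℓ ^ 9))) := Real.log_le_log (by linarith) hq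
    have h2 : Real.log (3 * (Dr * Real.exp (ℓ ^ 9))) = Real.log 3 + ℓ + ℓ ^ 9 := by
      rw [Real.log_mul (by norm_num) (mul_pos hDr0 (Real.exp_pos _)).ne',
        Real.log_mul hDr0.ne' (Real.exp_pos _).ne', Real.log_exp, ← hDr, Real.log_exp]
      ring
    linarith
  have hlq0 : 0 ≤ 1 + Real.log q := by have := Real.log_nonneg hq1; linarith
  exact mul_le_mul hsqrt hlogq hlq0 (by positivity)

/-- (ii) The `X`-budget at the band scale: for `1 ≤ X₀ ≤ X ≤ Y ≤ P^{1+δ}` and `σ ≥ ½ − 1/𝓛⁹`,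
`X^{−σ} ≤ e^{1+δ}/√X₀` (`X^{−σ} ≤ X^{−1/2}·X^{1/log P}` and `X^{1/log P} ≤ (P^{1+δ})^{1/log P} = e^{1+δ}`). [folklore] -/
private theorem budget_X_band {ℓ δ σ X Y X₀ : ℝ} (hℓ : 0 < ℓ) (hδ : 0 < δ) (hσ1 : 1 / 2 - 1 / ℓ ^ 9 ≤ σ)
    (hX₀ : 1 ≤ X₀) (hX : X₀ ≤ X) (hXY : X ≤ Y) (hY : Y ≤ Real.exp (ℓ ^ 9) ^ (1 + δ)) :
    X ^ (-σ) ≤ Real.exp (1 + δ) / Real.sqrt X₀ := by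
  have hℓ9 : 0 < ℓ ^ 9 := by positivity
  have hX1 : 1 ≤ X := hX₀.trans hX
  have hX0 : 0 < X := by linarith
  have h1 : X ^ (-σ) ≤ X ^ (-(1 / 2 - 1 / ℓ ^ 9)) :=
    Real.rpow_le_rpow_of_exponent_le hX1 (by linarith)
  have h2 : X ^ (-(1 / 2 - 1 / ℓ ^ 9)) = X ^ (1 / ℓ ^ 9) * X ^ (-(1 / 2 : ℝ)) := by
    rw [← Real.rpow_add hX0]; congr 1; ring
  have h3 : X ^ (1 / ℓ ^ 9) ≤ Real.exp (1 + δ) := by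
    calc X ^ (1 / ℓ ^ 9) ≤ (Real.exp (ℓ ^ 9) ^ (1 + δ)) ^ (1 / ℓ ^ 9) :=
          Real.rpow_le_rpow hX0.le (hXY.trans hY) (by positivity)
      _ = Real.exp (1 + δ) := by
          rw [← Real.exp_mul, ← Real.exp_mul]; congr 1; field_simp
  have h4 : X ^ (-(1 / 2 : ℝ)) ≤ (Real.sqrt X₀)⁻¹ := by
    rw [Real.rpow_neg hX0.le, ← Real.sqrt_eq_rpow]
    exact inv_anti₀ (Real.sqrt_pos.mpr (by linarith)) (Real.sqrt_le_sqrt hX)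
  calc X ^ (-σ) ≤ X ^ (1 / ℓ ^ 9) * X ^ (-(1 / 2 : ℝ)) := h1.trans h2.le
    _ ≤ Real.exp (1 + δ) * (Real.sqrt X₀)⁻¹ :=
        mul_le_mul h3 h4 (Real.rpow_nonneg hX0.le _) (Real.exp_pos _).le
    _ = Real.exp (1 + δ) / Real.sqrt X₀ := (div_eq_mul_inv _ _).symm

/-- (iii) The bracket `1 + (log Y − log X)/𝓛⁹ + ‖s‖(1 + 1/σ)` lies in `[0, (52+δ)𝓛⁵¹⁹]`. [folklore] -/
private theorem budget_bracket' {ℓ δ σ ns X Y : ℝ} (hδ : 0 < δ) (hℓ1 : 1 ≤ ℓ) (h14 : 1 / 4 ≤ σ)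
    (hns0 : 0 ≤ ns) (hns : ns ≤ 2 + 8 * ℓ ^ 519) (hX1 : 1 ≤ X) (hXY : X ≤ Y)
    (hY : Y ≤ Real.exp (ℓ ^ 9) ^ (1 + δ)) :
    0 ≤ 1 + (Real.log Y - Real.log X) / ℓ ^ 9 + ns * (1 + 1 / σ) ∧
      1 + (Real.log Y - Real.log X) / ℓ ^ 9 + ns * (1 + 1 / σ) ≤ (52 + δ) * ℓ ^ 519 := by
  have hℓ0 : 0 < ℓ := by linarith
  have hℓ9pos : 0 < ℓ ^ 9 := by positivity
  have hσ0 : 0 < σ := by linarith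
  have hσ4 : 1 / σ ≤ 4 := by rw [div_le_iff₀ hσ0]; linarith
  have hσinv0 : 0 < 1 / σ := one_div_pos.mpr hσ0
  have hX0 : 0 < X := by linarith
  have hY0 : 0 < Y := by linarith
  have hlogX0 : 0 ≤ Real.log X := Real.log_nonneg hX1
  have hlogXY : Real.log X ≤ Real.log Y := Real.log_le_log hX0 hXY
  have hlogY : Real.log Y ≤ (1 + δ) * ℓ ^ 9 := by
    have h1 : Real.log Y ≤ Real.log (Real.exp (ℓ ^ 9) ^ (1 + δ)) := Real.log_le_log hY0 hY
    rwa [Real.log_rpow (Real.exp_pos _), Real.log_exp] at h1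
  have hA0 : 0 ≤ (Real.log Y - Real.log X) / ℓ ^ 9 := div_nonneg (by linarith) hℓ9pos.le
  have hA : (Real.log Y - Real.log X) / ℓ ^ 9 ≤ 1 + δ := by
    rw [div_le_iff₀ hℓ9pos]; nlinarith
  have hB0 : 0 ≤ ns * (1 + 1 / σ) := mul_nonneg hns0 (by linarith)
  have hB : ns * (1 + 1 / σ) ≤ (2 + 8 * ℓ ^ 519) * 5 := by
    have h519 : 0 ≤ ℓ ^ 519 := pow_nonneg hℓ0.le 519
    exact mul_le_mul hns (by linarith) (by linarith) (by linarith)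
  have h519 : 1 ≤ ℓ ^ 519 := one_le_pow₀ hℓ1
  have hd : δ ≤ δ * ℓ ^ 519 := le_mul_of_one_le_right hδ.le h519
  constructor
  · linarith
  · linarith

/-- The threshold `X₀ = D·P·𝓛^{2k}` has `√X₀ = e^{𝓛/2}·e^{𝓛⁹/2}·𝓛^k` (`D = e^𝓛`, `P = e^{𝓛⁹}`). [folklore] -/
private theorem sqrt_threshold {ℓ Dr : ℝ} (hℓ : 0 ≤ ℓ) (hDr : Real.exp ℓ = Dr) (k : ℕ) :
    Real.sqrt (Dr * Real.exp (ℓ ^ 9) * (ℓ ^ k) ^ 2) = Real.exp (ℓ / 2) * Real.exp (ℓ ^ 9 / 2) * ℓ ^ k := by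
  rw [← hDr, Real.sqrt_mul (mul_nonneg (Real.exp_pos _).le (Real.exp_pos _).le),
    Real.sqrt_mul (Real.exp_pos _).le, Real.sqrt_sq (pow_nonneg hℓ k), ← Real.exp_half, ← Real.exp_half]

/-! ### The invisible tail at the band scale -/

/-- **THE INVISIBLE TAIL AT THE BAND SCALE** (`0 < δ`, `A : ℕ`): there is `C > 0` such that for all large `D`, every
primitive quadratic `χ (mod D)`, every member `x = (p, ψ)` of the family, every 1-Lipschitz profile `g` with `‖g‖ ≤ 1`,
every `s` with `½ − 1/log P ≤ Re s ≤ 2`, `|Im s| ≤ 8t₀`, and every block `D·P·𝓛^{1056+2A} ≤ X ≤ Y ≤ P^{1+δ}`,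
`‖Σ_{X<n≤Y} χψ(n) g(log n/log P) n^{−s}‖ ≤ C·𝓛^{−A}` (with `C = 4(52+δ)e^{2+δ}`). The threshold is
`z = log X/log P ≥ 1 + α̃ + (537+2A)·log𝓛/𝓛⁹`, i.e. the TRUE band edge `pDt₀` up to a factor `𝓛^{O(1)}` — not a fixed
`P^{1+ε}`; the saving is any fixed power of `𝓛 = log D`. [cite: MontgomeryVaughan2007, Thm 9.18]
[cite: Zhang2022LandauSiegel, §2 (2.30); §4 p. 8; §7 (7.2)] -/
theorem tailInvisible_bandScale {δ : ℝ} (hδ : 0 < δ) (A : ℕ) :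
    ∃ C : ℝ, 0 < C ∧ Skeleton.ForAllLarge fun D _ χ =>
      ∀ (x : Skeleton.Chr D) (g : ℝ → ℂ), LipschitzWith 1 g → (∀ z, ‖g z‖ ≤ 1) →
        ∀ s : ℂ, 1 / 2 - 1 / Real.log (Skeleton.bigP D) ≤ s.re → s.re ≤ 2 → |s.im| ≤ 8 * Skeleton.t0 D →
          ∀ X Y : ℕ, (D : ℝ) * Skeleton.bigP D * Skeleton.ell D ^ (1056 + 2 * A) ≤ (X : ℝ) → X ≤ Y →
            (Y : ℝ) ≤ Skeleton.bigP D ^ (1 + δ) →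
            ‖∑ n ∈ Finset.Ioc X Y, Skeleton.pc χ x n * g (Real.log n / Real.log (Skeleton.bigP D)) *
                (n : ℂ) ^ (-s)‖ ≤ C * (Skeleton.ell D ^ A)⁻¹ := by
  have hC : 0 < 4 * (52 + δ) * Real.exp (2 + δ) := mul_pos (by linarith) (Real.exp_pos _)
  refine ⟨4 * (52 + δ) * Real.exp (2 + δ), hC, ?_⟩
  refine Skeleton.ForAllLarge.of_le ⌈Real.exp 4⌉₊ ?_
  intro D _ χ hD _hquad hχ x g hg hg1 s hσ1 hσ2 hsim X Y hX hXY hY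
  -- parameters
  have hℓ4 : 4 ≤ ell D := le_ell_of_ceil_exp_le'' hD
  have hℓ1 : 1 ≤ ell D := by linarith
  have hℓ0 : 0 < ell D := by linarith
  have hP : 0 < bigP D := Real.exp_pos _
  have hP1 : 1 ≤ bigP D := by rw [bigP]; exact Real.one_le_exp (by positivity)
  have hlogP : Real.log (bigP D) = ell D ^ 9 := by rw [bigP, Real.log_exp]
  have hℓ9 : ell D ≤ ell D ^ 9 := by
    calc ell D = ell D ^ 1 := (pow_one _).symm
      _ ≤ ell D ^ 9 := pow_le_pow_right₀ hℓ1 (by norm_num)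
  have hlogP4 : 4 ≤ Real.log (bigP D) := by rw [hlogP]; linarith
  have hlogPpos : 0 < Real.log (bigP D) := by linarith
  -- `D ≥ 3`, `q = Dp ≥ 2`, `χψ` primitive
  have hDpos : (0 : ℝ) < D := by exact_mod_cast Nat.pos_of_ne_zero (NeZero.ne D)
  have hexpℓ : Real.exp (ell D) = D := by rw [ell]; exact Real.exp_log hDpos
  have hD3r : (3 : ℝ) ≤ D := by
    have h2 : Real.exp 4 ≤ Real.exp (ell D) := Real.exp_le_exp.mpr hℓ4
    have h3 : (4 : ℝ) + 1 ≤ Real.exp 4 := Real.add_one_le_exp 4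
    linarith
  have hD3 : 3 ≤ D := by exact_mod_cast hD3r
  have hD1 : (1 : ℝ) ≤ D := by linarith
  have hp2 : 2 ≤ x.p := x.prime.two_le
  have hq : 2 ≤ D * x.p := le_trans (by norm_num) (Nat.mul_le_mul hD3 hp2)
  have hprim : (psiChi χ x).IsPrimitive := psiChiPrimitive_holds D χ x hD3 hχ
  -- `s`
  have hinv4 : 1 / Real.log (bigP D) ≤ 1 / 4 := one_div_le_one_div_of_le (by norm_num) hlogP4
  have hσpos : 0 < s.re := by linarith
  have h14 : 1 / 4 ≤ s.re := by linarith
  have hsnorm : ‖s‖ ≤ 2 + 8 * ell D ^ 519 := by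
    have h1 := Complex.norm_le_abs_re_add_abs_im s
    have h2 : |s.re| ≤ 2 := abs_le.mpr ⟨by linarith, hσ2⟩
    have h3 : |s.im| ≤ 8 * ell D ^ 519 := by simpa only [t0] using hsim
    linarith
  -- the threshold `X₀ = D·P·(𝓛^k)²`, `k = 528 + A`
  set k : ℕ := 528 + A with hk
  set X₀ : ℝ := (D : ℝ) * bigP D * (ell D ^ k) ^ 2 with hX₀
  have hX₀eq : (D : ℝ) * Skeleton.bigP D * Skeleton.ell D ^ (1056 + 2 * A) = X₀ := by
    have hpow : Skeleton.ell D ^ (1056 + 2 * A) = (Skeleton.ell D ^ k) ^ 2 := by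
      rw [hk, ← pow_mul]; congr 1; ring
    rw [hX₀, hpow]
  rw [hX₀eq] at hX
  have hX₀1 : 1 ≤ X₀ := by
    rw [hX₀]
    have h1 : (1 : ℝ) ≤ (ell D ^ k) ^ 2 := one_le_pow₀ (one_le_pow₀ hℓ1)
    calc (1 : ℝ) = 1 * 1 * 1 := by ring
      _ ≤ (D : ℝ) * bigP D * (ell D ^ k) ^ 2 := by gcongr
  -- `X`, `Y`
  have hX1r : (1 : ℝ) ≤ X := hX₀1.trans hX
  have hX1 : 1 ≤ X := by exact_mod_cast hX1r
  have hX0 : (0 : ℝ) < X := by linarith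
  have hXYr : (X : ℝ) ≤ Y := by exact_mod_cast hXY
  -- the engine, for `θ = χψ (mod Dp)`, `L = log P`
  have key := norm_sum_Ioc_char_profile_cpow_le hq hprim hg hg1 hlogPpos hσpos hX1 hXY
  have hsum : ∑ n ∈ Finset.Ioc X Y, Skeleton.pc χ x n * g (Real.log n / Real.log (Skeleton.bigP D)) *
      (n : ℂ) ^ (-s) = ∑ n ∈ Finset.Ioc X Y, psiChi χ x (n : ZMod (D * x.p)) *
        (g (Real.log n / Real.log (Skeleton.bigP D)) * (n : ℂ) ^ (-s)) := by
    refine Finset.sum_congr rfl fun n _ => ?_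
    rw [Section11AFE.psiChi_natCast, mul_assoc]
  rw [hsum]
  refine key.trans ?_
  rw [hlogP]
  -- bookkeeping
  have hqr : ((D * x.p : ℕ) : ℝ) ≤ 3 * ((D : ℝ) * Real.exp (ell D ^ 9)) := by
    have := chr_p_le_three_mul_bigP'' x hℓ1
    rw [bigP] at this
    push_cast
    nlinarith
  have hq1 : (1 : ℝ) ≤ ((D * x.p : ℕ) : ℝ) := by exact_mod_cast le_trans (by norm_num) hq
  have hi := budget_sqrt_log' hℓ4 hexpℓ hq1 hqr
  have hσ1' : 1 / 2 - 1 / ell D ^ 9 ≤ s.re := by rwa [hlogP] at hσ1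
  have hY' : (Y : ℝ) ≤ Real.exp (ell D ^ 9) ^ (1 + δ) := by rwa [bigP] at hY
  have hii := budget_X_band hℓ0 hδ hσ1' hX₀1 hX hXYr hY'
  have hiii := budget_bracket' hδ hℓ1 h14 (norm_nonneg s) hsnorm hX1r hXYr hY'
  have hsqrtX₀ : Real.sqrt X₀ = Real.exp (ell D / 2) * Real.exp (ell D ^ 9 / 2) * ell D ^ k := by
    rw [hX₀, ← hexpℓ, bigP]; exact sqrt_threshold hℓ0.le rfl k
  rw [hsqrtX₀] at hii
  -- assemble: (e·E·4𝓛⁹)·(e^{1+δ}/(E·𝓛^k))·((52+δ)𝓛⁵¹⁹) = 4(52+δ)e^{2+δ}·𝓛^{528−k} = C·𝓛^{−A}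
  set E : ℝ := Real.exp (ell D / 2) * Real.exp (ell D ^ 9 / 2) with hE
  have hE0 : 0 < E := mul_pos (Real.exp_pos _) (Real.exp_pos _)
  have hℓk : 0 < ell D ^ k := pow_pos hℓ0 k
  have hℓA : 0 < ell D ^ A := pow_pos hℓ0 A
  have step : Real.sqrt ((D * x.p : ℕ) : ℝ) * (1 + Real.log ((D * x.p : ℕ) : ℝ)) *
      ((X : ℝ) ^ (-s.re) * (1 + (Real.log Y - Real.log X) / ell D ^ 9 + ‖s‖ * (1 + 1 / s.re))) ≤
      (Real.exp 1 * E * (4 * ell D ^ 9)) * ((Real.exp (1 + δ) / (E * ell D ^ k)) * ((52 + δ) * ell D ^ 519)) :=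
    mul_le_mul hi (mul_le_mul hii hiii.2 hiii.1 (by positivity))
      (mul_nonneg (Real.rpow_nonneg hX0.le _) hiii.1) (by positivity)
  refine step.trans (le_of_eq ?_)
  have hkA : ell D ^ k = ell D ^ 528 * ell D ^ A := by rw [hk, pow_add]
  rw [hkA, Real.exp_add 2 δ, show (2:ℝ) = 1 + 1 by norm_num, Real.exp_add 1 1, Real.exp_add 1 δ]
  field_simp

end Literature.NumberTheory.LFunctions.Zhang2022.KnifeEdgeInvisibleTail

end
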